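import Summits.Ventures.PackingBounds.Energy.FivePointRieszFiveUnique
import Summits.Ventures.PackingBounds.Energy.FivePointRieszFiveOptimal
import Summits.Ventures.PackingBounds.Energy.FivePointBipyramidIsometry
import HarnessLib

/-!
# Five points on `S²`, Riesz 5-energy: the ground state is unique up to isometry

Framing: lottery ticket; floor = certified bounds/negative ranges. Venture `PackingBounds`, cell
`pub-packcert`, energy family E3PT (pub-packcert-energy gen 17; files adapted from the gen-12 `FivePointRieszThree` companions).

Assembly of the kernel-checked sharp d = 6 three-point certificate over `ℚ(√2,√3)` (`riesz_five_five_points`), its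
complementary-slackness rigidity (`riesz_five_five_points_rigid`) and the Gram-matrix isometry lemma
(`Bipyramid5.isometric`): every minimiser of the Riesz 5-energy `Σ 1/‖x-y‖⁵` among five points of `S²`
is the image of the explicit triangular bipyramid `Config.Bipyramid.pts` under a linear isometry of
`ℝ³`; any two minimisers are isometric. (R. E. Schwartz, arXiv:2301.05090, by a computer-assisted
subdivision; here from an exact SDP certificate.)
-/

noncomputable section

open Finset
open scoped RealInnerProductSpace

namespace Summit.Ventures.PackingBounds.Energy

open Summit.Ventures.PackingBounds.Config

/-- **Riesz 5-energy of five points, uniqueness:** any two minimisers (`Σ_{x≠y} 1/‖x-y‖⁵ = 1/16 + (3/2)√2 + (2/9)√3`)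
are related by a linear isometry of `ℝ³`. -/
theorem FivePointRieszFive.minimisers_isometric (C C' : Finset (EuclideanSpace ℝ (Fin 3)))
    (hC : ∀ x ∈ C, ‖x‖ = 1) (h5 : C.card = 5)
    (hmin : ∑ x ∈ C, ∑ y ∈ C.erase x, 1 / ‖x - y‖ ^ 5 = 1 / 16 + 3 / 2 * Real.sqrt 2 + 2 / 9 * Real.sqrt 3)
    (hC' : ∀ x ∈ C', ‖x‖ = 1) (h5' : C'.card = 5)
    (hmin' : ∑ x ∈ C', ∑ y ∈ C'.erase x, 1 / ‖x - y‖ ^ 5 = 1 / 16 + 3 / 2 * Real.sqrt 2 + 2 / 9 * Real.sqrt 3) :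
    ∃ Ψ : EuclideanSpace ℝ (Fin 3) ≃ₗᵢ[ℝ] EuclideanSpace ℝ (Fin 3), C' = C.image Ψ :=
  Bipyramid5.isometric C C' hC h5 (FivePointRieszFive.riesz_five_five_points_rigid C hC h5 hmin).2.2
    hC' h5' (FivePointRieszFive.riesz_five_five_points_rigid C' hC' h5' hmin').2.2

/-- **Riesz 5-energy of five points, the ground state:** every minimiser is the image of
`Config.Bipyramid.pts` under a linear isometry of `ℝ³`. -/
theorem FivePointRieszFive.ground_state_unique (C : Finset (EuclideanSpace ℝ (Fin 3)))
    (hC : ∀ x ∈ C, ‖x‖ = 1) (h5 : C.card = 5)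
    (hmin : ∑ x ∈ C, ∑ y ∈ C.erase x, 1 / ‖x - y‖ ^ 5 = 1 / 16 + 3 / 2 * Real.sqrt 2 + 2 / 9 * Real.sqrt 3) :
    ∃ Ψ : EuclideanSpace ℝ (Fin 3) ≃ₗᵢ[ℝ] EuclideanSpace ℝ (Fin 3), C = Bipyramid.pts.image Ψ :=
  FivePointRieszFive.minimisers_isometric Bipyramid.pts C Bipyramid.norm_pts Bipyramid.card_pts
    FivePointRieszFive.bipyramid_riesz_five_energy hC h5 hmin

end Summit.Ventures.PackingBounds.Energy
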